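import Summits.QuantumAdvantage.QuantumAdvantage.Theorems.CubicForrelationNearExactIsExactEighteenPairing

/-!
# Crux `CubicForrelation.NearExactIsExact` (stmt-QuantumAdvantage-14043) — n = 18, TWO-SIDED: at level `≥ 8` (`W_g ∈ 256ℤ`) the boundary
  value forces exactness: `Φ ≥ 63/64 ⇒ Φ = 1`

Certificate seat `b2b-cforr-cert` (gen 6).  HONEST FRAMING: a theorem about cubic Boolean pairs on 18 bits (finite slice `n = 18` of the crux) —
the level-8 boundary configuration of the certified bound `θ₁₈ ≤ 63/64` is excluded two-sidedly (level `≥ 9` is the bent endgame); NOT summit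
progress.

`el8_levelEight_ge`: for cubic `f, g : 𝔽₂¹⁸ → 𝔽₂` with `W_g = 256·u''` and `Φ(f,g) ≥ 63/64`: `Φ(f,g) = 1`.  Proof.  If every `u''` is even we are
at level 9: `g` is bent (then `Φ = 1` or `≤ 31/32`, Hou + Reed–Muller) or the capacity is `≤ 31/32` (`tw_top`).  Otherwise `p = [u'' odd]` is cubic
(tower), the budget `Σ(u − 8s)² = 16Σ(u'' − 2s)² = 2²⁵(1−Φ) ≤ 2¹⁹` (`u = 4u''`) pays `≥ 1` per odd point and `RM(3,18)` gives `#P ≥ 2¹⁵`: so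
`P = {u'' odd}` is a 15-FLAT `x₁ ⊕ V₀`, `u'' = 2s` off `P`, `e := u'' − 2s = ±1` on `P`, `Φ = 63/64`.  THREE directions with all seven combinations
outside `V₀` (`ep_dirs3`, `4·2¹⁵ < 2¹⁸`); the general 6- and 7-flat sums (`16 ∣ Σ₆ u`, `32 ∣ Σ₇ u`; Ax `8Σ(−1)^f ∈ 32ℤ, 64ℤ`) localise (`ep_loc3`) to
`4Σ₃ e`, `4Σ₄ e` and give (H3)/(H4); the engine `fl1_flat_l1` yields `Σ|(e1_P)^| ≤ 2¹⁹`, while the pairing needs `Σ_y (−1)^g (4e1_P)^(y) = 2²⁴`.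

References: J. Ax (1964) / R. J. McEliece (1972); MacWilliams–Sloane (1977) Ch. 13–15; X.-D. Hou (1998); R. O'Donnell (2014) §3.3.  Everything
below is proved from Mathlib and the tree; axioms are the standard three.
-/

set_option linter.dupNamespace false -- D-0017: single-problem summit ⇒ `QuantumAdvantage.QuantumAdvantage` by design

noncomputable section

namespace Summit.QuantumAdvantage.QuantumAdvantage.Theorems.CubicForrelation.NearExactIsExact

open Finset
open Literature.Computability.QuantumComplexity
open Literature.Computability.QuantumComplexity.BuzetChailloux (bxor zeroVec bxor_bxor_cancel_left bxor_zeroVec zeroVec_bxor bxor_comm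
  bxor_self)
open Literature.Computability.QuantumComplexity.DerivativeWalsh (W)

/-- **Level `≥ 8` on 18 bits: `Φ ≥ 63/64 ⇒ Φ = 1`.**  For cubic `f, g : 𝔽₂¹⁸ → 𝔽₂` with `W_g = 256·u''` and `Φ(f,g) ≥ 63/64` the pair is
exact.  Finite-slice statement; NOT summit progress. [this work] -/
theorem el8_levelEight_ge (f g : (Fin (9 + 9) → Bool) → Bool) (hf : IsDegLeFun 3 f) (hg : IsDegLeFun 3 g)
    (u'' : (Fin (9 + 9) → Bool) → ℤ) (hu'' : ∀ x, W (fun y => signOf (g y)) x = (2 : ℝ) ^ 8 * (u'' x : ℝ))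
    (hΦ : (63 / 64 : ℝ) ≤ forrelation f g) : forrelation f g = 1 := by
  classical
  -- level 9: the bent endgame
  by_cases hall : ∀ x, ¬ Odd (u'' x)
  · have hu₉ := tw_level_up g u'' hu'' hall
    rcases tw_top (d := 4) g (fun x => u'' x / 2) hg hu₉ (by intro k hk hkn; omega) with hbent | hcap
    · rcases tw_bent_end (by norm_num) f g hf hg hbent with h | h
      · exact h
      · exfalso; norm_num at h; linarith
    · exfalso; have := tw_forrelation_le_of_cap f g hcap; norm_num at this; linarith
  exfalso
  push Not at hall
  obtain ⟨x₁, hx₁⟩ := hall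
  -- `u = 4u''` at the Ax level `6`
  set u : (Fin (9 + 9) → Bool) → ℤ := fun x => 4 * u'' x with hudef
  have hu : ∀ x, W (fun y => signOf (g y)) x = (2 : ℝ) ^ 6 * (u x : ℝ) := by
    intro x; rw [hu'' x]; simp only [u]; push_cast; ring
  -- the parity of `u''` is cubic
  have hp : IsDegLeFun 3 (fun x => decide (Odd (u'' x))) :=
    stub_walshTower stub_axParity (9 + 9) 8 3 g u'' hg hu'' (by intro k hk hkn; omega)
  have hp' : IsDegLeFun (2 + 1) (fun x => decide (Odd (u'' x))) := hp
  -- budget `Σ (u'' − 2s)² ≤ 2¹⁵`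
  have hbud := ep_budget18 f g u hu
  have hB : (∑ x, (u'' x - 2 * sZ (f x)) ^ 2 : ℤ) ≤ 2 ^ 15 := by
    have h16 : ∀ x, (u x - 8 * sZ (f x)) ^ 2 = 16 * (u'' x - 2 * sZ (f x)) ^ 2 := fun x => by simp only [u]; ring
    have h' : ((∑ x, (u x - 8 * sZ (f x)) ^ 2 : ℤ) : ℝ) ≤ 2 ^ 19 := by rw [hbud]; nlinarith
    have h'' : (∑ x, (u x - 8 * sZ (f x)) ^ 2 : ℤ) ≤ 2 ^ 19 := by exact_mod_cast h'
    rw [sum_congr rfl fun x _ => h16 x, ← mul_sum] at h''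
    linarith
  -- RM: `#P ≥ 2¹⁵`
  set P := univ.filter (fun x : Fin (9 + 9) → Bool => Odd (u'' x)) with hPdef
  have hmemP : ∀ x, x ∈ P ↔ Odd (u'' x) := fun x => by simp [hPdef]
  have hfilt : (univ.filter fun x : Fin (9 + 9) → Bool => decide (Odd (u'' x)) = true) = P := filter_congr fun x _ => by simp
  have hRM := bb_rmWeight_holds (9 + 9) 3 (fun x => decide (Odd (u'' x))) hp ⟨x₁, by simpa using hx₁⟩
  rw [hfilt] at hRM
  have hPge : 2 ^ 15 ≤ #P := by
    have h2 : (2 : ℕ) ^ (9 + 9) = 2 ^ 3 * 2 ^ 15 := by norm_num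
    rw [h2] at hRM
    exact Nat.le_of_mul_le_mul_left hRM (by positivity)
  -- everything is tight
  have hsumP : (∑ x, (if Odd (u'' x) then 1 else 0 : ℤ)) = #P := by rw [sum_boole]
  have hnonneg : ∀ x, 0 ≤ (u'' x - 2 * sZ (f x)) ^ 2 - (if Odd (u'' x) then 1 else 0 : ℤ) := by
    intro x
    by_cases h : Odd (u'' x)
    · rw [if_pos h]
      have h0 := Int.odd_iff.1 h
      have : u'' x - 2 * sZ (f x) ≤ -1 ∨ 1 ≤ u'' x - 2 * sZ (f x) := by
        rcases tp_sZ_cases (f x) with hs | hs <;> rw [hs] <;> omega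
      have := tp_sq_ge (k := 1) (by norm_num) this
      linarith
    · rw [if_neg h]; have := sq_nonneg (u'' x - 2 * sZ (f x)); linarith
  have hsum0 : ∑ x, ((u'' x - 2 * sZ (f x)) ^ 2 - (if Odd (u'' x) then 1 else 0 : ℤ)) = 0 := by
    refine le_antisymm ?_ (sum_nonneg fun x _ => hnonneg x)
    rw [sum_sub_distrib, hsumP]
    have : (2 : ℤ) ^ 15 ≤ #P := by exact_mod_cast hPge
    linarith
  have hzero' : ∀ x, (u'' x - 2 * sZ (f x)) ^ 2 - (if Odd (u'' x) then 1 else 0 : ℤ) = 0 :=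
    fun x => (sum_eq_zero_iff_of_nonneg fun y _ => hnonneg y).1 hsum0 x (mem_univ x)
  have hoff : ∀ x, ¬ Odd (u'' x) → u'' x - 2 * sZ (f x) = 0 := by
    intro x hx
    have h := hzero' x
    rw [if_neg hx, sub_zero] at h
    exact (pow_eq_zero_iff two_ne_zero).1 h
  have hon : ∀ x, Odd (u'' x) → u'' x - 2 * sZ (f x) = 1 ∨ u'' x - 2 * sZ (f x) = -1 := by
    intro x hx
    have h := hzero' x
    rw [if_pos hx] at h
    have h1 : (u'' x - 2 * sZ (f x)) * (u'' x - 2 * sZ (f x)) = 1 := by rw [← pow_two]; linarith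
    exact mul_self_eq_one_iff.1 h1
  have hPcard : #P = 2 ^ 15 := by
    have hle : (#P : ℤ) ≤ 2 ^ 15 := by
      rw [← hsumP]
      exact le_trans (sum_le_sum fun x _ => by have := hnonneg x; linarith) hB
    have hle' : #P ≤ 2 ^ 15 := by exact_mod_cast hle
    omega
  have hΦeq : forrelation f g = 63 / 64 := by
    have hT : (∑ x, (u x - 8 * sZ (f x)) ^ 2 : ℤ) = 2 ^ 19 := by
      have h16 : ∀ x, (u x - 8 * sZ (f x)) ^ 2 = 16 * ((u'' x - 2 * sZ (f x)) ^ 2 - (if Odd (u'' x) then 1 else 0 : ℤ)) +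
          16 * (if Odd (u'' x) then 1 else 0 : ℤ) := fun x => by simp only [u]; ring
      rw [sum_congr rfl fun x _ => h16 x, sum_add_distrib, ← mul_sum, ← mul_sum, hsum0, hsumP, hPcard]
      norm_num
    have h : ((∑ x, (u x - 8 * sZ (f x)) ^ 2 : ℤ) : ℝ) = 2 ^ 19 := by exact_mod_cast hT
    rw [hbud] at h
    linarith
  -- `P` is a 15-flat
  have hmw := mw_flat_of_minweight 2 (fun x => decide (Odd (u'' x))) hp' (by rw [hfilt, hPcard]; norm_num)
  rw [hfilt] at hmw
  obtain ⟨h0, hadd, hcardV, hcoset⟩ := hmw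
  set V₀ := univ.filter (fun a : Fin (9 + 9) → Bool => ∀ x, decide (Odd (u'' (bxor x a))) = decide (Odd (u'' x))) with hV₀
  have hS : P = V₀.image (bxor x₁) := hcoset x₁ (by simpa using hx₁)
  rw [hPcard] at hcardV
  -- three transversal directions
  obtain ⟨t₁, -, t₂, -, t₃, -, n1, n2, n21, n3, n31, n32, n321⟩ := ep_dirs3 univ V₀ (by
    rw [hcardV, card_univ, Fintype.card_fun, Fintype.card_bool, Fintype.card_fin]; norm_num)
  -- the sign pattern and the vanishing of the residual off `P`
  set e : (Fin (9 + 9) → Bool) → ℤ := fun x => u'' x - 2 * sZ (f x) with hedef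
  have he : ∀ x ∈ P, e x = 1 ∨ e x = -1 := fun x hx => hon x ((hmemP x).1 hx)
  have hF0 : ∀ y, y ∉ P → u y - 8 * sZ (f y) = 0 := by
    intro y hy
    have := hoff y (fun h => hy ((hmemP y).2 h))
    simp only [u]; linarith
  have hFe : ∀ y, u y - 8 * sZ (f y) = 4 * e y := fun y => by simp only [u, e]; ring
  have hPV : ∀ x, x ∈ P → ∀ a ∈ V₀, bxor x a ∈ P := fun x hx a ha => fl1_coset_vadd hadd hS hx ha
  have hz : ∀ p ∈ P, ∀ w, w ∉ V₀ → u (bxor p w) - 8 * sZ (f (bxor p w)) = 0 :=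
    fun p hp w hw => hF0 _ (fl1_coset_out h0 hadd hS hp hw)
  -- localisation by the three directions
  have hloc : ∀ {k : ℕ} (x : Fin (9 + 9) → Bool) (a : Fin k → Fin (9 + 9) → Bool),
      (∀ ε : Fin k → Bool, (fun j => x j ^^ decide (Odd #(univ.filter fun i => ε i && a i j))) ∈ P) →
      ∑ ε : Fin (k + 3) → Bool, (u (fun j => x j ^^ decide (Odd #(univ.filter fun i =>
          ε i && (Matrix.vecCons t₁ (Matrix.vecCons t₂ (Matrix.vecCons t₃ a)) : Fin (k + 3) → Fin (9 + 9) → Bool) i j))) -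
        8 * sZ (f (fun j => x j ^^ decide (Odd #(univ.filter fun i =>
          ε i && (Matrix.vecCons t₁ (Matrix.vecCons t₂ (Matrix.vecCons t₃ a)) : Fin (k + 3) → Fin (9 + 9) → Bool) i j))))) =
      ∑ ε : Fin k → Bool, 4 * e (fun j => x j ^^ decide (Odd #(univ.filter fun i => ε i && a i j))) := by
    intro k x a hin
    have key := ep_loc3 (fun y => u y - 8 * sZ (f y)) x t₁ t₂ t₃ a
      (fun ε => hz _ (hin ε) t₁ n1) (fun ε => hz _ (hin ε) t₂ n2)
      (fun ε => by rw [iw_bxor_assoc]; exact hz _ (hin ε) _ n21)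
      (fun ε => hz _ (hin ε) t₃ n3)
      (fun ε => by rw [iw_bxor_assoc]; exact hz _ (hin ε) _ n31)
      (fun ε => by rw [iw_bxor_assoc]; exact hz _ (hin ε) _ n32)
      (fun ε => by rw [iw_bxor_assoc, iw_bxor_assoc]; exact hz _ (hin ε) _ n321)
    beta_reduce at key
    rw [key]
    exact sum_congr rfl fun ε _ => hFe _
  -- (H3) and (H4)
  have H3 : ∀ x ∈ P, ∀ a b c : Fin (9 + 9) → Bool, a ∈ V₀ → b ∈ V₀ → c ∈ V₀ →
      (4 : ℤ) ∣ ∑ ε : Fin 3 → Bool, e (fun j => x j ^^ decide (Odd #(univ.filter fun i =>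
        ε i && (![a, b, c] : Fin 3 → Fin (9 + 9) → Bool) i j))) := by
    intro x hx a b c ha hb hc
    have hin : ∀ ε : Fin 3 → Bool, (fun j => x j ^^ decide (Odd #(univ.filter fun i =>
        ε i && (![a, b, c] : Fin 3 → Fin (9 + 9) → Bool) i j))) ∈ P :=
      fun ε => fr_mem_flatPt3 V₀ h0 (· ∈ P) hPV hx ![a, b, c] (fun i => by fin_cases i <;> assumption) ε
    have h16 := fs_flat_sum_dvd (e := 4) g u hg hu x ![t₁, t₂, t₃, a, b, c] (by norm_num)
    obtain ⟨zf, hzf⟩ := sl_sum_sZ_flat f hf x ![t₁, t₂, t₃, a, b, c]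
    have hzf' : ∑ ε : Fin 6 → Bool, 8 * sZ (f (fun j => x j ^^ decide (Odd #(univ.filter fun i =>
          ε i && (![t₁, t₂, t₃, a, b, c] : Fin 6 → Fin (9 + 9) → Bool) i j)))) = 16 * (2 * zf) := by
      rw [← mul_sum, hzf]; norm_num; ring
    have h16n : (16 : ℤ) ∣ ∑ ε : Fin 6 → Bool, u (fun j => x j ^^ decide (Odd #(univ.filter fun i =>
          ε i && (![t₁, t₂, t₃, a, b, c] : Fin 6 → Fin (9 + 9) → Bool) i j))) := by
      have e16 : (2 : ℤ) ^ 4 = 16 := by norm_num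
      rw [e16] at h16; exact h16
    have h16' : (16 : ℤ) ∣ ∑ ε : Fin 6 → Bool, (u (fun j => x j ^^ decide (Odd #(univ.filter fun i =>
          ε i && (![t₁, t₂, t₃, a, b, c] : Fin 6 → Fin (9 + 9) → Bool) i j))) -
        8 * sZ (f (fun j => x j ^^ decide (Odd #(univ.filter fun i =>
          ε i && (![t₁, t₂, t₃, a, b, c] : Fin 6 → Fin (9 + 9) → Bool) i j))))) := by
      rw [sum_sub_distrib, hzf']
      exact dvd_sub h16n (Dvd.intro _ rfl)
    rw [hloc x ![a, b, c] hin, ← mul_sum] at h16'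
    obtain ⟨k16, hk16⟩ := h16'
    exact ⟨k16, by linarith⟩
  have H4 : ∀ x ∈ P, ∀ a₀ a₁ a₂ a₃ : Fin (9 + 9) → Bool, a₀ ∈ V₀ → a₁ ∈ V₀ → a₂ ∈ V₀ → a₃ ∈ V₀ →
      (8 : ℤ) ∣ ∑ ε : Fin 4 → Bool, e (fun j => x j ^^ decide (Odd #(univ.filter fun i =>
        ε i && (![a₀, a₁, a₂, a₃] : Fin 4 → Fin (9 + 9) → Bool) i j))) := by
    intro x hx a₀ a₁ a₂ a₃ ha₀ ha₁ ha₂ ha₃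
    have hin : ∀ ε : Fin 4 → Bool, (fun j => x j ^^ decide (Odd #(univ.filter fun i =>
        ε i && (![a₀, a₁, a₂, a₃] : Fin 4 → Fin (9 + 9) → Bool) i j))) ∈ P :=
      fun ε => fr_mem_flatPt4 V₀ h0 (· ∈ P) hPV hx ![a₀, a₁, a₂, a₃] (fun i => by fin_cases i <;> assumption) ε
    have h32 := fs_flat_sum_dvd (e := 5) g u hg hu x ![t₁, t₂, t₃, a₀, a₁, a₂, a₃] (by norm_num)
    obtain ⟨zf, hzf⟩ := sl_sum_sZ_flat f hf x ![t₁, t₂, t₃, a₀, a₁, a₂, a₃]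
    have hzf' : ∑ ε : Fin 7 → Bool, 8 * sZ (f (fun j => x j ^^ decide (Odd #(univ.filter fun i =>
          ε i && (![t₁, t₂, t₃, a₀, a₁, a₂, a₃] : Fin 7 → Fin (9 + 9) → Bool) i j)))) = 32 * (2 * zf) := by
      rw [← mul_sum, hzf]; norm_num; ring
    have h32n : (32 : ℤ) ∣ ∑ ε : Fin 7 → Bool, u (fun j => x j ^^ decide (Odd #(univ.filter fun i =>
          ε i && (![t₁, t₂, t₃, a₀, a₁, a₂, a₃] : Fin 7 → Fin (9 + 9) → Bool) i j))) := by
      have e32 : (2 : ℤ) ^ 5 = 32 := by norm_num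
      rw [e32] at h32; exact h32
    have h32' : (32 : ℤ) ∣ ∑ ε : Fin 7 → Bool, (u (fun j => x j ^^ decide (Odd #(univ.filter fun i =>
          ε i && (![t₁, t₂, t₃, a₀, a₁, a₂, a₃] : Fin 7 → Fin (9 + 9) → Bool) i j))) -
        8 * sZ (f (fun j => x j ^^ decide (Odd #(univ.filter fun i =>
          ε i && (![t₁, t₂, t₃, a₀, a₁, a₂, a₃] : Fin 7 → Fin (9 + 9) → Bool) i j))))) := by
      rw [sum_sub_distrib, hzf']
      exact dvd_sub h32n (Dvd.intro _ rfl)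
    rw [hloc x ![a₀, a₁, a₂, a₃] hin, ← mul_sum] at h32'
    obtain ⟨k32, hk32⟩ := h32'
    exact ⟨k32, by linarith⟩
  -- the engine and the pairing
  have hE := fl1_flat_l1 V₀ P x₁ h0 hadd hS e he H3 H4
  set A : (Fin (9 + 9) → Bool) → ℝ := fun x => if x ∈ P then (e x : ℝ) else 0 with hA
  have hAτ : (fun x => (u x : ℝ) - 8 * signOf (f x)) = fun x => 4 * A x := by
    funext x
    have h2 : (u x : ℝ) - 8 * signOf (f x) = (((u x - 8 * sZ (f x) : ℤ)) : ℝ) := by push_cast; rw [tp_sZ_cast]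
    rw [h2]
    by_cases hx : x ∈ P
    · simp only [A, if_pos hx]; rw [hFe x]; push_cast; ring
    · simp only [A, if_neg hx]; rw [hF0 x hx]; norm_num
  have hpair := ep_pairing18 f g u hu
  rw [hΦeq, hAτ] at hpair
  have hpair' : ∑ y, signOf (g y) * W A y = 2 ^ 22 := by
    have e2 : ∀ y, signOf (g y) * W (fun x => 4 * A x) y = 4 * (signOf (g y) * W A y) := fun y => by
      rw [fl1_W_smul]; ring
    have h30 : (2 : ℝ) ^ 30 * (1 - 63 / 64) = 4 * 2 ^ 22 := by norm_num
    rw [sum_congr rfl fun y _ => e2 y, ← mul_sum, h30] at hpair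
    linarith
  have hge : (2 : ℝ) ^ 22 ≤ ∑ y, |W A y| := by rw [← hpair']; exact fl1_pairing_le_l1 g (W A)
  have hsq : ((2 : ℝ) ^ 22) ^ 2 ≤ (∑ y, |W A y|) ^ 2 := pow_le_pow_left₀ (by positivity) hge 2
  norm_num at hE hsq
  linarith

end Summit.QuantumAdvantage.QuantumAdvantage.Theorems.CubicForrelation.NearExactIsExact

end
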